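import Summits.BirchSwinnertonDyer.Rank1Residual.Supersingular.MazurTateParity
import Summits.BirchSwinnertonDyer.Rank1Residual.Supersingular.MazurTateLayerConsistency
import Literature.NumberTheory.EllipticCurves.Rank1Residual.Predicates
import HarnessLib

/-!
# `λ(L♯) ≡ λ(L♭) ≡ λ(L_p^±) ≡ ord_{s=1} L(E, s) (mod 2)`: parity of the signed supersingular
# `λ`-invariants (cell `b2b-bsdres`, supersingular family, prover B = unit `b2b-bsdres-additive-p3`, gen 5)

HONEST FRAMING (run/shared/lean/b2b/bsd-rank1-residual/, verbatim in every file): the goal of the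
cell is to DELETE the COMBINATION-SHAPED residual classes of the Birch–Swinnerton-Dyer formula for
ALL analytic-rank `≤ 1` elliptic curves over `ℚ` — "full BSD formula for every rank `≤ 1` curve in
class `C`" assembled STRICTLY from published theorems — so that the rank-`≤ 1` remainder becomes
exactly the CONSTRUCTION-SHAPED classes, which are TYPED (missing-input `Prop`s), NOT attempted.
This is not "finishing BSD". THEOREMS ONLY (no definition, no named fact; nothing about any
particular curve is asserted; nothing booked; labels unchanged).

## What this file proves

`MazurTateParity.lean` (this gen): for `Θ ∈ Λ` the Mazur–Tate element `θ_n(f)` of a form with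
Fricke sign `−σ` at an odd prime `p ∤ N`, `Θ ≠ 0`, `μ(Θ) = 0` ⇒ `(−1)^{λ(Θ)} = σ`. The gen-4 READING
(`MazurTateLayerConsistency`: `λ(θ_n) = deg ω_n^± + λ(L^•)` at every admissible layer, for THE
Sprung pair) transfers the parity to the signed `p`-adic `L`-functions, because `deg ω_n^+` and
`deg ω_n^-` are EVEN (sums of `φ(p^j) = p^{j−1}(p − 1)`, `p` odd):

* §1 `natDegree_cyclotomicOmegaPlus/Minus` (`= ∑ φ(p^{2k})`, `∑ φ(p^{2k−1})`), their evenness, and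
  the existence of admissible layers of either parity (`exists_odd_layer`, `exists_even_layer`);
* §2 **`neg_one_pow_lam_sharp` / `neg_one_pow_lam_flat`**: at an odd supersingular-type prime
  (`p ≠ 2` good, `p ∣ a_p` — this includes X8: `p = 3`, `a_3 = ±3`), for `f` the newform of `E = W`
  with `f(-1/(Nτ)) = -σ N τ² f(τ)` and ANY (= the unique) Sprung pair `(L♯, L♭)`:
  `L♯ ≠ 0 ∧ μ(L♯) = 0 ⇒ (−1)^{λ(L♯)} = σ`, and the same for `L♭`; any-level form with `σ = −ε_N(f)`
  and the CONDUCTOR-LEVEL form **`Even λ(L^•) ↔ Even ord_{s=1} L(E,s)`**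
  (`even_lam_sharp/flat_iff_even_analyticRank`);
* §3 `a_p = 0` (X6/X7): the same for Kobayashi–Pollack's `L_p^ε`, `IsSignedPAdicLFunction f p ε L`
  (`neg_one_pow_lam_signed`, `even_lam_signed_iff_even_analyticRank`);
* §4 cell readings: on X8 (`p = 3`, `a_3 = ±3`) in analytic rank one, `λ(L♯_3(E))` and `λ(L♭_3(E))`
  are ODD whenever `μ = 0` (`X8.odd_lam_sharp/flat_of_analyticRank_eq_one`) — so the census value
  `λ^• = 1` is the least possible and `λ^• = 2` never occurs; in analytic rank zero they are EVEN.

CENSUS CHECK (iw-2 `tables/ss_signed_by_epsilon.tsv`, two engines, N < 2·10⁴, all `μ = 0`):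
X8 r = 0: 572/572 entries even (`λ ∈ {0,2,4,6,8,10}`), X8 r = 1: 78/78 odd (`λ ∈ {1,3,5,7,9,11,15}`);
X7: 520/520 even, 144/144 odd; X6: 336/336 even — 1 650/1 650 (memo `X8-ROUTE-B.md` §10).

References: [Ota2018] Prop. 5.16, p. 498; [Pollack2003] Prop. 6.9–6.10, §6.5 (`ω_n^±`), Lemma 4.7
(`q_n`); [Sprung2017] §3, Cor. 3.6, Thm. 1.12; [Kobayashi2003] (3.4)–(3.5); [GreenbergLNM1716] §5 p. 181.
-/

set_option autoImplicit false

noncomputable section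

open scoped Classical MatrixGroups

open CongruenceSubgroup Polynomial WeierstrassCurve Literature.NumberTheory.EllipticCurves
  Literature.NumberTheory.EllipticCurves.ModularForms
  Literature.NumberTheory.EllipticCurves.Sprung2017
  Literature.NumberTheory.EllipticCurves.Rank1Residual
  Summit.BirchSwinnertonDyer.Rank1Residual.X1.MuLambda

namespace Summit.BirchSwinnertonDyer.Rank1Residual.Supersingular

/-! ## §1. `deg ω_n^±`: closed forms, evenness, admissible layers -/

section Degrees

variable (p : ℕ) [hp : Fact p.Prime]

omit hp in
/-- `deg (X + 1) = 1` over `ℤ`. [folklore] -/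
private theorem natDegree_X_add_one_int : (X + 1 : ℤ[X]).natDegree = 1 := by
  rw [← C_1, natDegree_X_add_C]

omit hp in
/-- `deg ω_n^+ = ∑_{1 ≤ k ≤ n/2} φ(p^{2k})` (Pollack's `q_n` bookkeeping). [cite: Pollack2003, §6.5 and Lemma 4.7] -/
theorem natDegree_cyclotomicOmegaPlus (n : ℕ) :
    (cyclotomicOmegaPlus p n).natDegree = ∑ k ∈ Finset.Icc 1 (n / 2), Nat.totient (p ^ (2 * k)) := by
  unfold cyclotomicOmegaPlus
  rw [natDegree_prod_of_monic]
  · refine Finset.sum_congr rfl fun k _ ↦ ?_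
    rw [natDegree_comp, natDegree_cyclotomic, natDegree_X_add_one_int, mul_one]
  · intro k _
    exact (cyclotomic.monic _ ℤ).comp (monic_X_add_C 1) (by rw [natDegree_X_add_one_int]; exact one_ne_zero)

omit hp in
/-- `deg ω_n^- = ∑_{1 ≤ k ≤ (n+1)/2} φ(p^{2k−1})`. [cite: Pollack2003, §6.5 and Lemma 4.7] -/
theorem natDegree_cyclotomicOmegaMinus (n : ℕ) :
    (cyclotomicOmegaMinus p n).natDegree =
      ∑ k ∈ Finset.Icc 1 ((n + 1) / 2), Nat.totient (p ^ (2 * k - 1)) := by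
  unfold cyclotomicOmegaMinus
  rw [natDegree_prod_of_monic]
  · refine Finset.sum_congr rfl fun k _ ↦ ?_
    rw [natDegree_comp, natDegree_cyclotomic, natDegree_X_add_one_int, mul_one]
  · intro k _
    exact (cyclotomic.monic _ ℤ).comp (monic_X_add_C 1) (by rw [natDegree_X_add_one_int]; exact one_ne_zero)

/-- **`deg ω_n^+` is even for odd `p`** (`φ(p^j) = p^{j−1}(p−1)`). [folklore] -/
theorem even_natDegree_cyclotomicOmegaPlus (hp2 : p ≠ 2) (n : ℕ) :
    Even (cyclotomicOmegaPlus p n).natDegree := by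
  rw [natDegree_cyclotomicOmegaPlus]
  refine Finset.even_sum _ fun k hk ↦ ?_
  rw [Finset.mem_Icc] at hk
  rw [Nat.totient_prime_pow hp.out (by omega)]
  exact (hp.out.even_sub_one hp2).mul_left _

/-- **`deg ω_n^-` is even for odd `p`.** [folklore] -/
theorem even_natDegree_cyclotomicOmegaMinus (hp2 : p ≠ 2) (n : ℕ) :
    Even (cyclotomicOmegaMinus p n).natDegree := by
  rw [natDegree_cyclotomicOmegaMinus]
  refine Finset.even_sum _ fun k hk ↦ ?_
  rw [Finset.mem_Icc] at hk
  rw [Nat.totient_prime_pow hp.out (by omega)]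
  exact (hp.out.even_sub_one hp2).mul_left _

/-- `n/2 ≤ deg ω_n^+` (each factor has degree `≥ 1`). [folklore] -/
theorem div_two_le_natDegree_cyclotomicOmegaPlus (n : ℕ) :
    n / 2 ≤ (cyclotomicOmegaPlus p n).natDegree := by
  rw [natDegree_cyclotomicOmegaPlus]
  calc n / 2 = (Finset.Icc 1 (n / 2)).card := by rw [Nat.card_Icc]; omega
    _ = ∑ k ∈ Finset.Icc 1 (n / 2), 1 := by rw [Finset.card_eq_sum_ones]
    _ ≤ _ := Finset.sum_le_sum fun k _ ↦ Nat.totient_pos.mpr (pow_pos hp.out.pos _)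

/-- `(n+1)/2 ≤ deg ω_n^-`. [folklore] -/
theorem succ_div_two_le_natDegree_cyclotomicOmegaMinus (n : ℕ) :
    (n + 1) / 2 ≤ (cyclotomicOmegaMinus p n).natDegree := by
  rw [natDegree_cyclotomicOmegaMinus]
  calc (n + 1) / 2 = (Finset.Icc 1 ((n + 1) / 2)).card := by rw [Nat.card_Icc]; omega
    _ = ∑ k ∈ Finset.Icc 1 ((n + 1) / 2), 1 := by rw [Finset.card_eq_sum_ones]
    _ ≤ _ := Finset.sum_le_sum fun k _ ↦ Nat.totient_pos.mpr (pow_pos hp.out.pos _)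

/-- **Admissible ODD layers exist**: for every `l` there is an odd `n` with `l + deg ω_n^+ < pⁿ`
(equivalently `l ≤ deg ω_n^-`; take `n = 2l + 1`). [folklore] -/
theorem exists_odd_layer (l : ℕ) : ∃ n : ℕ, Odd n ∧ l + (cyclotomicOmegaPlus p n).natDegree < p ^ n := by
  refine ⟨2 * l + 1, ⟨l, rfl⟩, ?_⟩
  have h1 := natDegree_cyclotomicOmegaPlus_add (p := p) (2 * l + 1)
  have h2 := succ_div_two_le_natDegree_cyclotomicOmegaMinus p (2 * l + 1)
  omega

/-- **Admissible EVEN layers exist**: for every `l` there is an even `n` with `l + deg ω_n^- < pⁿ`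
(take `n = 2l + 2`). [folklore] -/
theorem exists_even_layer (l : ℕ) :
    ∃ n : ℕ, Even n ∧ l + (cyclotomicOmegaMinus p n).natDegree < p ^ n := by
  refine ⟨2 * l + 2, ⟨l + 1, by ring⟩, ?_⟩
  have h1 := natDegree_cyclotomicOmegaPlus_add (p := p) (2 * l + 2)
  have h2 := div_two_le_natDegree_cyclotomicOmegaPlus p (2 * l + 2)
  omega

end Degrees

/-! ## §2. `♯/♭`: `(−1)^{λ(L♯)} = (−1)^{λ(L♭)} = σ` -/

section SharpFlat

variable {W : WeierstrassCurve ℚ} [W.IsElliptic] [W.IsGloballyMinimal] {N : ℕ} [NeZero N]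
  {f : CuspForm (Gamma0 N) 2} {p : ℕ} [hp : Fact p.Prime]

/-- **`(−1)^{λ(L♯)} = σ`.** For `p ≠ 2`, `E = W` with good reduction at `p` and `p ∣ a_p`
(supersingular type; X8 = `p = 3`, `a_3 = ±3` included), `f ∈ S₂(Γ₀(N))` the newform of `E` with
`f(-1/(Nτ)) = -σ N τ² f(τ)`, `σ = ±1`, and ANY Sprung pair `(L♯, L♭)` (= THE pair, `IsSprungPair.unique`)
with `L♯ ≠ 0`, `μ(L♯) = 0`: `(−1)^{λ(L♯)} = σ`. Proof: at an odd layer `n` with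
`λ(L♯) + deg ω_n^+ < pⁿ` (`exists_odd_layer`) the Mazur–Tate element `Θ` (integral,
`exists_integral_mazurTate_of_isSprungPair`) has `μ(Θ) = 0` and `λ(Θ) = λ(L♯) + deg ω_n^+`
(`lam_mazurTate_eq_of_lam_sharp`), `deg ω_n^+` is even, and `(−1)^{λ(Θ)} = σ`
(`neg_one_pow_lam_mazurTate`). [cite: Ota2018, Prop. 5.16 and p. 498]
[cite: Pollack2003, Prop. 6.9 and Prop. 6.10] [cite: Sprung2017, §3 and Cor. 3.6] -/
theorem neg_one_pow_lam_sharp {σ : ℤ} (hσ : σ = 1 ∨ σ = -1) (hW : IsFrickeEigen N f (-(σ : ℂ)))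
    (hp2 : p ≠ 2) (hf : IsNewformOf W f) (hgood : W.HasGoodReductionAtPrime p)
    (hap : (p : ℤ) ∣ W.frobeniusTrace p) {Lsharp Lflat : IwasawaAlgebra p}
    (hSP : IsSprungPair f p (W.frobeniusTrace p) Lsharp Lflat) (hL0 : Lsharp ≠ 0)
    (hμ : mu Lsharp = 0) : (-1 : ℤ) ^ lam Lsharp = σ := by
  obtain ⟨n, hn, hlt⟩ := exists_odd_layer p (lam Lsharp)
  obtain ⟨Q, hQ⟩ := exists_integral_mazurTate_of_isSprungPair hp2 hf hgood hap hSP n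
  obtain ⟨hΘ0, hμΘ, hlamΘ⟩ := lam_mazurTate_eq_of_lam_sharp hp2 hf hgood hap hSP hL0 hμ hn hlt hQ.symm
  have key := neg_one_pow_lam_mazurTate hσ hW hp2 (not_dvd_level_of_isNewformOf hf hgood) hQ.symm hΘ0 hμΘ
  rwa [hlamΘ, pow_add, (even_natDegree_cyclotomicOmegaPlus p hp2 n).neg_one_pow, mul_one] at key

/-- **`(−1)^{λ(L♭)} = σ`**: the same for the flat function, through an even layer
(`exists_even_layer`, `lam_mazurTate_eq_of_lam_flat`, `deg ω_n^-` even). [cite: Ota2018, Prop. 5.16 and p. 498]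
[cite: Pollack2003, Prop. 6.9 and Prop. 6.10] [cite: Sprung2017, §3 and Cor. 3.6] -/
theorem neg_one_pow_lam_flat {σ : ℤ} (hσ : σ = 1 ∨ σ = -1) (hW : IsFrickeEigen N f (-(σ : ℂ)))
    (hp2 : p ≠ 2) (hf : IsNewformOf W f) (hgood : W.HasGoodReductionAtPrime p)
    (hap : (p : ℤ) ∣ W.frobeniusTrace p) {Lsharp Lflat : IwasawaAlgebra p}
    (hSP : IsSprungPair f p (W.frobeniusTrace p) Lsharp Lflat) (hL0 : Lflat ≠ 0)
    (hμ : mu Lflat = 0) : (-1 : ℤ) ^ lam Lflat = σ := by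
  obtain ⟨n, hn, hlt⟩ := exists_even_layer p (lam Lflat)
  obtain ⟨Q, hQ⟩ := exists_integral_mazurTate_of_isSprungPair hp2 hf hgood hap hSP n
  obtain ⟨hΘ0, hμΘ, hlamΘ⟩ := lam_mazurTate_eq_of_lam_flat hp2 hf hgood hap hSP hL0 hμ hn hlt hQ.symm
  have key := neg_one_pow_lam_mazurTate hσ hW hp2 (not_dvd_level_of_isNewformOf hf hgood) hQ.symm hΘ0 hμΘ
  rwa [hlamΘ, pow_add, (even_natDegree_cyclotomicOmegaMinus p hp2 n).neg_one_pow, mul_one] at key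

omit [W.IsElliptic] [W.IsGloballyMinimal] in
/-- The Fricke sign of the newform of an elliptic curve, as an integer `σ = −ε_N(f) = ±1` with the
pointwise eigen-property (Atkin–Lehner; tree theorems `IsNewform0.frickeInvolution_eq_smul_holds`,
`frickeEigenvalue_eq_one_or_eq_neg_one_holds`, `isFrickeEigen_of_frickeInvolution_eq_smul`).
[cite: AtkinLehner1970, §2 and Thm. 3] -/
theorem exists_sign_isFrickeEigen (hf : IsNewformOf W f) :
    ∃ σ : ℤ, (σ = 1 ∨ σ = -1) ∧ (σ : ℂ) = -frickeEigenvalue f ∧ IsFrickeEigen N f (-(σ : ℂ)) := by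
  have hsm := IsNewform0.frickeInvolution_eq_smul_holds (N := N) (k := (2 : ℤ)) hf.1
  have hFE : IsFrickeEigen N f (frickeEigenvalue f) := isFrickeEigen_of_frickeInvolution_eq_smul N hsm
  rcases IsNewform0.frickeEigenvalue_eq_one_or_eq_neg_one_holds (N := N) (k := (2 : ℤ)) hf.1 with
    h1 | h1
  · refine ⟨-1, Or.inr rfl, by rw [h1]; push_cast; ring, ?_⟩
    have : (-((-1 : ℤ) : ℂ)) = frickeEigenvalue f := by rw [h1]; push_cast; ring
    rw [this]; exact hFE
  · refine ⟨1, Or.inl rfl, by rw [h1]; push_cast; ring, ?_⟩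
    have : (-((1 : ℤ) : ℂ)) = frickeEigenvalue f := by rw [h1]; push_cast; ring
    rw [this]; exact hFE

omit [W.IsGloballyMinimal] in
/-- At the CONDUCTOR level the sign is the root number: `f(-1/(N_W τ)) = -w_E N_W τ² f(τ)`
(`rootNumber_eq_neg_frickeEigenvalue`, Hecke). [cite: GreenbergLNM1716, §1 (p. 68, `w_E`)] -/
theorem isFrickeEigen_neg_rootNumber [NeZero (W.conductorNorm ℤ)]
    {f : CuspForm (Gamma0 (W.conductorNorm ℤ)) 2} (hf : IsNewformOf W f) :
    IsFrickeEigen (W.conductorNorm ℤ) f (-((W.rootNumber : ℤ) : ℂ)) := by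
  have hw : (W.rootNumber : ℂ) = -frickeEigenvalue f :=
    rootNumber_eq_neg_frickeEigenvalue (fun _ _ ↦ IsNewform0.exists_functional_equation_holds)
      (fun _ _ ↦ IsNewform0.frickeEigenvalue_eq_one_or_eq_neg_one_holds) hf
  have hsm := IsNewform0.frickeInvolution_eq_smul_holds (N := W.conductorNorm ℤ) (k := (2 : ℤ)) hf.1
  have hFE : IsFrickeEigen (W.conductorNorm ℤ) f (frickeEigenvalue f) :=
    isFrickeEigen_of_frickeInvolution_eq_smul _ hsm
  rw [hw, neg_neg]; exact hFE

/-- **`Even λ(L♯) ↔ Even ord_{s=1} L(E, s)`** at the conductor level (`p ≠ 2` good, `p ∣ a_p`,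
`L♯ ≠ 0`, `μ(L♯) = 0`; the Sprung pair of the newform `f ∈ S₂(Γ₀(N_W))`). [cite: Ota2018, Prop. 5.16 and p. 498]
[cite: GreenbergLNM1716, §5 (p. 181)] -/
theorem even_lam_sharp_iff_even_analyticRank [NeZero (W.conductorNorm ℤ)]
    {f : CuspForm (Gamma0 (W.conductorNorm ℤ)) 2} (hp2 : p ≠ 2) (hf : IsNewformOf W f)
    (hgood : W.HasGoodReductionAtPrime p) (hap : (p : ℤ) ∣ W.frobeniusTrace p)
    {Lsharp Lflat : IwasawaAlgebra p} (hSP : IsSprungPair f p (W.frobeniusTrace p) Lsharp Lflat)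
    (hL0 : Lsharp ≠ 0) (hμ : mu Lsharp = 0) : Even (lam Lsharp) ↔ Even W.analyticRank := by
  have hpar : Even W.analyticRank ↔ W.rootNumber = 1 :=
    Literature.Barriers.BirchSwinnertonDyer.even_analyticRank_iff_of_isNewformOf_conductorLevel hf
  have key := neg_one_pow_lam_sharp W.rootNumber_eq_one_or (isFrickeEigen_neg_rootNumber hf) hp2 hf
    hgood hap hSP hL0 hμ
  rw [hpar, ← key, neg_one_pow_eq_one_iff_even (by norm_num)]

/-- **`Even λ(L♭) ↔ Even ord_{s=1} L(E, s)`** at the conductor level. [cite: Ota2018, Prop. 5.16 and p. 498]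
[cite: GreenbergLNM1716, §5 (p. 181)] -/
theorem even_lam_flat_iff_even_analyticRank [NeZero (W.conductorNorm ℤ)]
    {f : CuspForm (Gamma0 (W.conductorNorm ℤ)) 2} (hp2 : p ≠ 2) (hf : IsNewformOf W f)
    (hgood : W.HasGoodReductionAtPrime p) (hap : (p : ℤ) ∣ W.frobeniusTrace p)
    {Lsharp Lflat : IwasawaAlgebra p} (hSP : IsSprungPair f p (W.frobeniusTrace p) Lsharp Lflat)
    (hL0 : Lflat ≠ 0) (hμ : mu Lflat = 0) : Even (lam Lflat) ↔ Even W.analyticRank := by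
  have hpar : Even W.analyticRank ↔ W.rootNumber = 1 :=
    Literature.Barriers.BirchSwinnertonDyer.even_analyticRank_iff_of_isNewformOf_conductorLevel hf
  have key := neg_one_pow_lam_flat W.rootNumber_eq_one_or (isFrickeEigen_neg_rootNumber hf) hp2 hf
    hgood hap hSP hL0 hμ
  rw [hpar, ← key, neg_one_pow_eq_one_iff_even (by norm_num)]

end SharpFlat

/-! ## §3. `a_p = 0`: Kobayashi–Pollack `L_p^ε` -/

section Signed

variable {W : WeierstrassCurve ℚ} [W.IsElliptic] [W.IsGloballyMinimal] {N : ℕ} [NeZero N]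
  {f : CuspForm (Gamma0 N) 2} {p : ℕ} [hp : Fact p.Prime]

open Literature.NumberTheory.EllipticCurves.Kobayashi2003 in
/-- **`(−1)^{λ(L_p^ε)} = σ` at `a_p = 0`** (X6/X7; `ε = −1` = the tree's `L⁺` = Sprung `♯`, odd layers;
`ε = +1` = `L⁻` = `♭`, even layers), for ANY (= the unique) `L` with `IsSignedPAdicLFunction f p ε L`,
`L ≠ 0`, `μ(L) = 0`; via Pollack's theorem (`pollack_exists_plusMinusPAdicLFunction_holds`) and
`isSprungPair_zero_iff`. [cite: Ota2018, Prop. 5.16 and p. 498] [cite: Pollack2003, Prop. 6.9, Prop. 6.10 and Prop. 6.18]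
[cite: Kobayashi2003, (3.4)–(3.5) (p. 7)] -/
theorem neg_one_pow_lam_signed {σ : ℤ} (hσ : σ = 1 ∨ σ = -1) (hW : IsFrickeEigen N f (-(σ : ℂ)))
    (hp2 : p ≠ 2) (hf : IsNewformOf W f) (hgood : W.HasGoodReductionAtPrime p)
    (hap : W.frobeniusTrace p = 0) {ε : ℤˣ} {L : IwasawaAlgebra p}
    (hL : IsSignedPAdicLFunction f p ε L) (hL0 : L ≠ 0) (hμ : mu L = 0) :
    (-1 : ℤ) ^ lam L = σ := by
  obtain ⟨Lplus, Lminus, -, -, hodd, heven⟩ :=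
    pollack_exists_plusMinusPAdicLFunction_holds (W := W) (f := f) (p := p) hp2 hf hgood hap
  have hSP : IsSprungPair f p (W.frobeniusTrace p) Lplus Lminus := by
    rw [hap]
    exact (isSprungPair_zero_iff f p Lplus Lminus).mpr ⟨hodd, heven⟩
  have hap' : (p : ℤ) ∣ W.frobeniusTrace p := by rw [hap]; exact dvd_zero _
  rcases Int.units_eq_one_or ε with rfl | rfl
  · have hLeq : L = Lminus := hL.unique ((isSignedPAdicLFunction_one_iff f p Lminus).mpr heven)
    subst hLeq
    exact neg_one_pow_lam_flat hσ hW hp2 hf hgood hap' hSP hL0 hμ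
  · have hLeq : L = Lplus := hL.unique ((isSignedPAdicLFunction_neg_one_iff f p Lplus).mpr hodd)
    subst hLeq
    exact neg_one_pow_lam_sharp hσ hW hp2 hf hgood hap' hSP hL0 hμ

open Literature.NumberTheory.EllipticCurves.Kobayashi2003 in
/-- **`Even λ(L_p^ε) ↔ Even ord_{s=1} L(E, s)`** at the conductor level, `a_p = 0`, either sign.
[cite: Ota2018, Prop. 5.16 and p. 498] [cite: GreenbergLNM1716, §5 (p. 181)] -/
theorem even_lam_signed_iff_even_analyticRank [NeZero (W.conductorNorm ℤ)]
    {f : CuspForm (Gamma0 (W.conductorNorm ℤ)) 2} (hp2 : p ≠ 2) (hf : IsNewformOf W f)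
    (hgood : W.HasGoodReductionAtPrime p) (hap : W.frobeniusTrace p = 0) {ε : ℤˣ}
    {L : IwasawaAlgebra p} (hL : IsSignedPAdicLFunction f p ε L) (hL0 : L ≠ 0) (hμ : mu L = 0) :
    Even (lam L) ↔ Even W.analyticRank := by
  have hpar : Even W.analyticRank ↔ W.rootNumber = 1 :=
    Literature.Barriers.BirchSwinnertonDyer.even_analyticRank_iff_of_isNewformOf_conductorLevel hf
  have key := neg_one_pow_lam_signed W.rootNumber_eq_one_or (isFrickeEigen_neg_rootNumber hf) hp2 hf
    hgood hap hL hL0 hμ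
  rw [hpar, ← key, neg_one_pow_eq_one_iff_even (by norm_num)]

end Signed

/-! ## §4. Cell readings: X8 (`p = 3`, `a_3 = ±3`) -/

section X8

variable {W : WeierstrassCurve ℚ} [W.IsElliptic] [W.IsGloballyMinimal] [NeZero (W.conductorNorm ℤ)]
  {f : CuspForm (Gamma0 (W.conductorNorm ℤ)) 2}

/-- **X8, analytic rank one: `λ(L♯_3(E))` is ODD** (hence `≥ 1`, and never `2`) whenever
`L♯ ≠ 0`, `μ(L♯) = 0` — for `f` the newform at the conductor level and any Sprung pair; the census
(iw-2, two engines, 39 pairs) shows `λ♯ ∈ {1, 3, 5, 9, 11, 15}`. Nothing booked.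
[cite: Ota2018, Prop. 5.16 and p. 498] [cite: Sprung2017, §3 and Cor. 3.6] -/
theorem X8.odd_lam_sharp_of_analyticRank_eq_one {p : ℕ} [Fact p.Prime] (hX : ClassX8 W p)
    (h1 : W.analyticRank = 1) (hf : IsNewformOf W f) {Lsharp Lflat : IwasawaAlgebra p}
    (hSP : IsSprungPair f p (W.frobeniusTrace p) Lsharp Lflat) (hL0 : Lsharp ≠ 0)
    (hμ : mu Lsharp = 0) : Odd (lam Lsharp) := by
  obtain ⟨hp3, ⟨hgood, hap⟩, -⟩ := hX
  subst hp3
  rw [← Nat.not_even_iff_odd, even_lam_sharp_iff_even_analyticRank (by decide) hf hgood hap hSP hL0 hμ,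
    h1]
  decide

/-- **X8, analytic rank one: `λ(L♭_3(E))` is ODD** (`L♭ ≠ 0`, `μ(L♭) = 0`); census `λ♭ ∈ {1,3,5,7,11}`.
[cite: Ota2018, Prop. 5.16 and p. 498] [cite: Sprung2017, §3 and Cor. 3.6] -/
theorem X8.odd_lam_flat_of_analyticRank_eq_one {p : ℕ} [Fact p.Prime] (hX : ClassX8 W p)
    (h1 : W.analyticRank = 1) (hf : IsNewformOf W f) {Lsharp Lflat : IwasawaAlgebra p}
    (hSP : IsSprungPair f p (W.frobeniusTrace p) Lsharp Lflat) (hL0 : Lflat ≠ 0)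
    (hμ : mu Lflat = 0) : Odd (lam Lflat) := by
  obtain ⟨hp3, ⟨hgood, hap⟩, -⟩ := hX
  subst hp3
  rw [← Nat.not_even_iff_odd, even_lam_flat_iff_even_analyticRank (by decide) hf hgood hap hSP hL0 hμ,
    h1]
  decide

/-- **X8, analytic rank zero: `λ(L♯_3(E))` and `λ(L♭_3(E))` are EVEN** (`L^• ≠ 0`, `μ(L^•) = 0`);
census: `λ ∈ {0, 2, 4, 6, 8, 10}` on 286 pairs × 2 colours. [cite: Ota2018, Prop. 5.16 and p. 498]
[cite: Sprung2017, §3 and Cor. 3.6] -/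
theorem X8.even_lam_of_analyticRank_eq_zero {p : ℕ} [Fact p.Prime] (hX : ClassX8 W p)
    (h0 : W.analyticRank = 0) (hf : IsNewformOf W f) {Lsharp Lflat : IwasawaAlgebra p}
    (hSP : IsSprungPair f p (W.frobeniusTrace p) Lsharp Lflat) :
    (Lsharp ≠ 0 → mu Lsharp = 0 → Even (lam Lsharp)) ∧ (Lflat ≠ 0 → mu Lflat = 0 → Even (lam Lflat)) := by
  obtain ⟨hp3, ⟨hgood, hap⟩, -⟩ := hX
  subst hp3
  refine ⟨fun hL0 hμ ↦ ?_, fun hL0 hμ ↦ ?_⟩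
  · rw [even_lam_sharp_iff_even_analyticRank (by decide) hf hgood hap hSP hL0 hμ, h0]; exact ⟨0, rfl⟩
  · rw [even_lam_flat_iff_even_analyticRank (by decide) hf hgood hap hSP hL0 hμ, h0]; exact ⟨0, rfl⟩

end X8

end Summit.BirchSwinnertonDyer.Rank1Residual.Supersingular

end
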